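import Mathlib
import HarnessLib
import Summits.HubbardSuperconductivity.HubbardSuperconductivity.Theorems.KLProgrammeKLRegimeTwoVolumeTowerStepCovZeroPullback
import Summits.HubbardSuperconductivity.HubbardSuperconductivity.Theorems.KLProgrammeKLRegimeTwoVolumeTowerStepCovZeroGram
import Summits.HubbardSuperconductivity.HubbardSuperconductivity.Theorems.KLProgrammeKLRegimeEngineE4ScaleDoorBridge

/-!
# Route `KLProgramme` — K3 VL child (stmt-HubbardSuperconductivity-23356), atom HUV-W, LEVEL 1 data (i)–(ii): the FIRST step covariance
# `klStepCov V M β μ K 0 = S(F̃_0)ᵀ·C^K_{(Λ₂,Λ₁]}·S(F̃_0)` IS A SUBMATRIX OF THE GRID-SANDWICHED SLICE, hence its weighted rows are UV-route rows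
# at the two cutoffs `Λ₂`, `Λ₁` — for EVERY admissible frame, NO depth window (cell gate-hubbard-kl, seat p3 g21)

The block step `(J₁, J₂, J′) = (1, 2, 1)` from the level-`0` datum of HUV-W (`…TwoVolumeSrcBlockIdentityF`, `…SrcBlockStepModelF` at `k = 0`) needs the
replica-Gram constant and the `klScaleWt 1`-weighted rows / columns of `klStepCov … K 0`.  p3 g17's flow-frame rows (`rowColSumWt_klStepCov_zero_flow`) carry
the window `Λw·4ⁿ ≤ ρ₀` and a space-only weight, useless at the top frame.  Here instead:

* §1 `sectorSubMatrix_one_eq_hubbardGridSub` — the sector substitution of the CONSTANT-ONE family at the lattice point `(j, x⃗)` IS the grid substitution at the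
  grid point `(2j, x⃗)` (`hubbardPlaneWave … (j, x⃗) = vertexPlaneWave … x⃗ (jβ/2M)`, `imagTime β M j = gridTime β 4M (2j)`);
* §1 **`klStepCov_zero_apply_eq_grid`** — with p3 g17's `klStepCov_zero_eq_pullback_one` (the scale-`0` fat multipliers are `≡ 1` on the slice) and
  `hubbardCovSliceCT = hubbardCovAboveCT Λ₂ − hubbardCovAboveCT Λ₁` (definition):
  `klStepCov … 0 (y,ℓ) (y′,ℓ′) = (S_{4M}ᵀC^K_{>Λ₂}S_{4M} − S_{4M}ᵀC^K_{>Λ₁}S_{4M}) (ι(y,ℓ)) (ι(y′,ℓ′))`, `ι(j, x⃗, ((ω,σ),c)) = (((2j, x⃗), σ), c)`;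
* §2 **`rowColSumWt_klStepCov_zero_of_gridRows`** — hence from `gridLabelWt`-weighted rows AND columns `≤ α₂`, `≤ α₁` of the two grid-sandwiched UV
  covariances: every `klScaleWt V M β r`-weighted row and column of `klStepCov … 0` is `≤ 2·(α₂ + α₁)` (the sector label `ω ∈ Fin 2` is invisible to `ι`:
  fibres of size `≤ sectorCount 0 = 2`; `klScaleWt_le_gridLabelWt`);
* §3 `isGramBoundedR_klStepCov_zero_uniform` — p3 g16's Gram constant made `β`-free (`(Λ₁β/π + 3)/β ≤ Λ₁/π + 3/128` for `β ≥ klBetaMin`).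

The UV rows `α₂`, `α₁` themselves are `rowSum_/colSum_scaleCutoff_gridLabelWt_le_X5 (d := 2, 1)` (`…EngineScaleCutoffAlphaW`, frame-generic); the
instantiated corollary is the companion file `…TwoVolumeSrcStepCovZeroAlphaW`.  Everything is proved; no definitions, no sorry.  Nothing asserts HUV, any stub,
VL, K3 or superconductivity.  [cite: BenfattoGiulianiMastropietro2006, §2.7 (2.66)–(2.67), §2.8 (2.80)–(2.81), §3 (3.3)]
-/

noncomputable section

namespace Summit.HubbardSuperconductivity.HubbardSuperconductivity.Theorems.TwoVolumeSource

set_option linter.dupNamespace false -- summit = problem name (single-conjunct summit), D-0017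

open Finset Literature.MathematicalPhysics.QuantumLattice Literature.Probability.LatticeModels
open Summit.HubbardSuperconductivity.HubbardSuperconductivity.Theorems.KLRegimeSplit
open Summit.HubbardSuperconductivity.HubbardSuperconductivity.Theorems.KLProgrammeLegKernels
open Summit.HubbardSuperconductivity.HubbardSuperconductivity.Theorems.EngineV8
open Summit.HubbardSuperconductivity.HubbardSuperconductivity.Theorems.TorusFourierL2
open scoped ComplexConjugate

variable {V M : ℕ} [NeZero V] [NeZero M]

/-! ## §1 The first step covariance is a submatrix of the grid-sandwiched slice -/

omit [NeZero V] [NeZero M] in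
/-- `2j < 4M` for a dual-lattice time index `j < 2M`. [folklore] -/
theorem two_mul_imagTimeIdx_lt (j : ImagTimeIdx M) : 2 * (j : ℕ) < 2 * (2 * M) := by have := j.isLt; omega

omit [NeZero V] in
/-- **The lattice plane wave at `(j, x⃗)` is the grid plane wave at the grid time `2j`** (`jβ/(2M) = (2j)β/(4M)`). [folklore] -/
theorem hubbardPlaneWave_eq_vertexPlaneWave_grid (β : ℝ) (c : Fin 2) (k : FreqMomentum V M) (y : SpaceTimeIdx V M) :
    hubbardPlaneWave V M β c k y =
      vertexPlaneWave V M β c k y.2 (gridTime β (2 * (2 * M)) ⟨2 * (y.1 : ℕ), two_mul_imagTimeIdx_lt y.1⟩) := by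
  have ht : gridTime β (2 * (2 * M)) ⟨2 * (y.1 : ℕ), two_mul_imagTimeIdx_lt y.1⟩ = imagTime β M y.1 := by
    have hM : (M : ℝ) ≠ 0 := by exact_mod_cast NeZero.ne M
    rw [gridTime, imagTime]
    push_cast
    field_simp
  rw [ht]
  rfl

omit [NeZero V] in
/-- **The sector substitution of the constant-one family is the grid substitution on the even grid times**:
`S(𝟙) K ((j, x⃗), ((ω,σ),c)) = S_{4M} K (((2j, x⃗), σ), c)`. [cite: BenfattoGiulianiMastropietro2006, §2.1 (2.5)] -/
theorem sectorSubMatrix_one_eq_hubbardGridSub (β : ℝ) (K : HubbardFieldIdx V M) (y : SpaceTimeIdx V M) (ℓ : SectorLeg (sectorCount 0)) :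
    sectorSubMatrix V M β (fun (_ : Fin (sectorCount 0)) (_ : FreqMomentum V M) => (1 : ℂ)) K (y, ℓ) =
      hubbardGridSub V M β (2 * (2 * M)) K (((⟨2 * (y.1 : ℕ), two_mul_imagTimeIdx_lt y.1⟩, y.2), ℓ.1.2), ℓ.2) := by
  rw [sectorSubMatrix_apply, hubbardGridSub, gridSubMatrix_apply]
  simp only [one_mul, hubbardPlaneWave_eq_vertexPlaneWave_grid]

/-- **`klStepCov … 0` entrywise IS the grid-sandwiched slice `S_{4M}ᵀ(C^K_{>Λ₂} − C^K_{>Λ₁})S_{4M}` at the even grid times**.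
[cite: BenfattoGiulianiMastropietro2006, §2.7 (2.66)–(2.67)] -/
theorem klStepCov_zero_apply_eq_grid {β : ℝ} (hβ : β ≠ 0) (μ : ℝ) (K : TrigPolyC4v) (Y Y' : SpaceTimeIdx V M × SectorLeg (sectorCount 0)) :
    klStepCov V M β μ K 0 Y Y' =
      ((hubbardGridSub V M β (2 * (2 * M))).transpose * hubbardCovAboveCT V M β μ 0 K (klScale klE0 2) * hubbardGridSub V M β (2 * (2 * M)))
          (((⟨2 * (Y.1.1 : ℕ), two_mul_imagTimeIdx_lt Y.1.1⟩, Y.1.2), Y.2.1.2), Y.2.2)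
          (((⟨2 * (Y'.1.1 : ℕ), two_mul_imagTimeIdx_lt Y'.1.1⟩, Y'.1.2), Y'.2.1.2), Y'.2.2) -
        ((hubbardGridSub V M β (2 * (2 * M))).transpose * hubbardCovAboveCT V M β μ 0 K (klScale klE0 1) * hubbardGridSub V M β (2 * (2 * M)))
          (((⟨2 * (Y.1.1 : ℕ), two_mul_imagTimeIdx_lt Y.1.1⟩, Y.1.2), Y.2.1.2), Y.2.2)
          (((⟨2 * (Y'.1.1 : ℕ), two_mul_imagTimeIdx_lt Y'.1.1⟩, Y'.1.2), Y'.2.1.2), Y'.2.2) := by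
  rw [klStepCov_zero_eq_pullback_one hβ μ K, hubbardCovSliceCT, Matrix.mul_sub, Matrix.sub_mul, Matrix.sub_apply]
  obtain ⟨y, ℓ⟩ := Y
  obtain ⟨y', ℓ'⟩ := Y'
  simp only [Matrix.mul_apply, Matrix.transpose_apply, sectorSubMatrix_one_eq_hubbardGridSub]

/-! ## §2 Weighted rows and columns from the grid rows at the two cutoffs -/

/-- A sum over `α` of a nonnegative function of `φ a` is at most twice the full sum when the fibres of `φ` have at most two points. [folklore] -/
theorem sum_comp_le_two_mul_sum {α γ : Type*} [Fintype α] [Fintype γ] [DecidableEq γ] (φ : α → γ) (f : γ → ℝ) (hf : ∀ c, 0 ≤ f c)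
    (h2 : ∀ c, (univ.filter fun a => φ a = c).card ≤ 2) : ∑ a, f (φ a) ≤ 2 * ∑ c, f c := by
  rw [← Finset.sum_fiberwise univ φ (fun a => f (φ a)), mul_sum]
  refine sum_le_sum fun c _ => ?_
  have : ∑ a ∈ univ.filter (fun a => φ a = c), f (φ a) = ((univ.filter fun a => φ a = c).card : ℝ) * f c := by
    rw [sum_congr rfl fun a ha => by rw [(mem_filter.1 ha).2], sum_const, nsmul_eq_mul]
  rw [this]
  have hc : ((univ.filter fun a => φ a = c).card : ℝ) ≤ 2 := by exact_mod_cast h2 c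
  nlinarith [hf c]

omit [NeZero M] in
/-- The fibres of `ι(j, x⃗, ((ω,σ),c)) = (((2j, x⃗), σ), c)` have at most `sectorCount 0 = 2` points (only `ω` is forgotten). [folklore] -/
theorem card_fibre_latticeToGrid_le_two (g : GridLeg (GridPoint V (2 * (2 * M)))) :
    (univ.filter fun Y : SpaceTimeIdx V M × SectorLeg (sectorCount 0) =>
      ((((⟨2 * (Y.1.1 : ℕ), two_mul_imagTimeIdx_lt Y.1.1⟩, Y.1.2), Y.2.1.2), Y.2.2) : GridLeg (GridPoint V (2 * (2 * M)))) = g).card ≤ 2 := by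
  classical
  have hsc : (univ : Finset (Fin (sectorCount 0))).card = 2 := by rw [Finset.card_univ, Fintype.card_fin]; rfl
  refine le_trans (Finset.card_le_card_of_injOn (t := (univ : Finset (Fin (sectorCount 0)))) (fun Y => Y.2.1.1) (fun _ _ => mem_univ _) ?_)
    hsc.le
  rintro ⟨⟨j₁, x₁⟩, ⟨⟨ω₁, σ₁⟩, c₁⟩⟩ h₁ ⟨⟨j₂, x₂⟩, ⟨⟨ω₂, σ₂⟩, c₂⟩⟩ h₂ hω
  simp only [coe_filter, Set.mem_setOf_eq, mem_univ, true_and] at h₁ h₂ hω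
  have h := h₁.trans h₂.symm
  simp only [Prod.mk.injEq, Fin.mk.injEq] at h
  obtain ⟨⟨⟨hj, hx⟩, hσ⟩, hc⟩ := h
  have hj' : j₁ = j₂ := Fin.ext (by omega)
  subst hj'; subst hx; subst hσ; subst hc; subst hω
  rfl

/-- **Weighted rows and columns of `klStepCov … 0` from the `gridLabelWt`-weighted rows and columns of the grid-sandwiched UV covariances at `Λ₂` and
`Λ₁`**: every `klScaleWt V M β r`-weighted row and column is `≤ 2·(α₂ + α₁)` (any rate `r`; `β ≥ 0`).
[cite: BenfattoGiulianiMastropietro2006, §2.8 (2.81), §3 (3.3)] -/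
theorem rowColSumWt_klStepCov_zero_of_gridRows {β : ℝ} (hβ : 0 < β) (μ : ℝ) (K : TrigPolyC4v) (r : ℕ) {α₂ α₁ : ℝ}
    (hrow₂ : ∀ X, ∑ Y, ‖((hubbardGridSub V M β (2 * (2 * M))).transpose * hubbardCovAboveCT V M β μ 0 K (klScale klE0 2) *
        hubbardGridSub V M β (2 * (2 * M))) X Y‖ * gridLabelWt V (2 * (2 * M)) β {gridLegPos X, gridLegPos Y} ≤ α₂)
    (hcol₂ : ∀ Y, ∑ X, ‖((hubbardGridSub V M β (2 * (2 * M))).transpose * hubbardCovAboveCT V M β μ 0 K (klScale klE0 2) *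
        hubbardGridSub V M β (2 * (2 * M))) X Y‖ * gridLabelWt V (2 * (2 * M)) β {gridLegPos X, gridLegPos Y} ≤ α₂)
    (hrow₁ : ∀ X, ∑ Y, ‖((hubbardGridSub V M β (2 * (2 * M))).transpose * hubbardCovAboveCT V M β μ 0 K (klScale klE0 1) *
        hubbardGridSub V M β (2 * (2 * M))) X Y‖ * gridLabelWt V (2 * (2 * M)) β {gridLegPos X, gridLegPos Y} ≤ α₁)
    (hcol₁ : ∀ Y, ∑ X, ‖((hubbardGridSub V M β (2 * (2 * M))).transpose * hubbardCovAboveCT V M β μ 0 K (klScale klE0 1) *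
        hubbardGridSub V M β (2 * (2 * M))) X Y‖ * gridLabelWt V (2 * (2 * M)) β {gridLegPos X, gridLegPos Y} ≤ α₁) :
    (∀ Y, ∑ Y', ‖klStepCov V M β μ K 0 Y Y'‖ * klScaleWt V M β r {latticeLegPos (2 * (2 * M)) Y, latticeLegPos (2 * (2 * M)) Y'} ≤
        2 * (α₂ + α₁)) ∧
    (∀ Y', ∑ Y, ‖klStepCov V M β μ K 0 Y Y'‖ * klScaleWt V M β r {latticeLegPos (2 * (2 * M)) Y, latticeLegPos (2 * (2 * M)) Y'} ≤
        2 * (α₂ + α₁)) := by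
  classical
  -- the embedding and its bookkeeping
  set ι : SpaceTimeIdx V M × SectorLeg (sectorCount 0) → GridLeg (GridPoint V (2 * (2 * M))) :=
    fun Y => (((⟨2 * (Y.1.1 : ℕ), two_mul_imagTimeIdx_lt Y.1.1⟩, Y.1.2), Y.2.1.2), Y.2.2) with hι
  set G₂ := (hubbardGridSub V M β (2 * (2 * M))).transpose * hubbardCovAboveCT V M β μ 0 K (klScale klE0 2) *
    hubbardGridSub V M β (2 * (2 * M)) with hG₂
  set G₁ := (hubbardGridSub V M β (2 * (2 * M))).transpose * hubbardCovAboveCT V M β μ 0 K (klScale klE0 1) *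
    hubbardGridSub V M β (2 * (2 * M)) with hG₁
  have hpos : ∀ Y : SpaceTimeIdx V M × SectorLeg (sectorCount 0), gridLegPos (ι Y) = latticeLegPos (2 * (2 * M)) Y := fun Y => rfl
  have hentry : ∀ Y Y', klStepCov V M β μ K 0 Y Y' = G₂ (ι Y) (ι Y') - G₁ (ι Y) (ι Y') := fun Y Y' =>
    klStepCov_zero_apply_eq_grid hβ.ne' μ K Y Y'
  -- the pointwise domination of each weighted entry
  have hterm : ∀ Y Y', ‖klStepCov V M β μ K 0 Y Y'‖ * klScaleWt V M β r {latticeLegPos (2 * (2 * M)) Y, latticeLegPos (2 * (2 * M)) Y'} ≤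
      (‖G₂ (ι Y) (ι Y')‖ + ‖G₁ (ι Y) (ι Y')‖) * gridLabelWt V (2 * (2 * M)) β {gridLegPos (ι Y), gridLegPos (ι Y')} := by
    intro Y Y'
    rw [hentry, hpos, hpos]
    exact mul_le_mul (norm_sub_le _ _) (klScaleWt_le_gridLabelWt β r _) (zero_le_one.trans (one_le_klScaleWt V M β r _)) (by positivity)
  have hfib : ∀ g, (univ.filter fun Y : SpaceTimeIdx V M × SectorLeg (sectorCount 0) => ι Y = g).card ≤ 2 :=
    fun g => card_fibre_latticeToGrid_le_two g
  constructor
  · intro Y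
    calc ∑ Y', ‖klStepCov V M β μ K 0 Y Y'‖ * klScaleWt V M β r {latticeLegPos (2 * (2 * M)) Y, latticeLegPos (2 * (2 * M)) Y'}
        ≤ ∑ Y', (fun g => (‖G₂ (ι Y) g‖ + ‖G₁ (ι Y) g‖) * gridLabelWt V (2 * (2 * M)) β {gridLegPos (ι Y), gridLegPos g}) (ι Y') :=
          sum_le_sum fun Y' _ => hterm Y Y'
      _ ≤ 2 * ∑ g, (‖G₂ (ι Y) g‖ + ‖G₁ (ι Y) g‖) * gridLabelWt V (2 * (2 * M)) β {gridLegPos (ι Y), gridLegPos g} :=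
          sum_comp_le_two_mul_sum ι (fun g => (‖G₂ (ι Y) g‖ + ‖G₁ (ι Y) g‖) * gridLabelWt V (2 * (2 * M)) β {gridLegPos (ι Y), gridLegPos g})
            (fun g => mul_nonneg (by positivity) (zero_le_one.trans (one_le_gridLabelWt _ _ _ _))) hfib
      _ ≤ 2 * (α₂ + α₁) := by
          have h := add_le_add (hrow₂ (ι Y)) (hrow₁ (ι Y))
          rw [← sum_add_distrib] at h
          refine mul_le_mul_of_nonneg_left (le_trans (le_of_eq (sum_congr rfl fun g _ => by ring)) h) (by norm_num)
  · intro Y'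
    calc ∑ Y, ‖klStepCov V M β μ K 0 Y Y'‖ * klScaleWt V M β r {latticeLegPos (2 * (2 * M)) Y, latticeLegPos (2 * (2 * M)) Y'}
        ≤ ∑ Y, (fun g => (‖G₂ g (ι Y')‖ + ‖G₁ g (ι Y')‖) * gridLabelWt V (2 * (2 * M)) β {gridLegPos g, gridLegPos (ι Y')}) (ι Y) :=
          sum_le_sum fun Y _ => hterm Y Y'
      _ ≤ 2 * ∑ g, (‖G₂ g (ι Y')‖ + ‖G₁ g (ι Y')‖) * gridLabelWt V (2 * (2 * M)) β {gridLegPos g, gridLegPos (ι Y')} :=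
          sum_comp_le_two_mul_sum ι (fun g => (‖G₂ g (ι Y')‖ + ‖G₁ g (ι Y')‖) * gridLabelWt V (2 * (2 * M)) β {gridLegPos g, gridLegPos (ι Y')})
            (fun g => mul_nonneg (by positivity) (zero_le_one.trans (one_le_gridLabelWt _ _ _ _))) hfib
      _ ≤ 2 * (α₂ + α₁) := by
          have h := add_le_add (hcol₂ (ι Y')) (hcol₁ (ι Y'))
          rw [← sum_add_distrib] at h
          refine mul_le_mul_of_nonneg_left (le_trans (le_of_eq (sum_congr rfl fun g _ => by ring)) h) (by norm_num)

/-! ## §3 The replica-Gram constant, `β`-free -/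

/-- **`klStepCov … 0` is replica-Gram-bounded with a `β`-free constant** for every admissible frame and `β ≥ klBetaMin`:
`κ₀′ = √(8(Λ₁/π + 3/128)(1793Λ₁ + 704)/Λ₁)` (p3 g16's `isGramBoundedR_klStepCov_zero_of_frameOK`, `(Λ₁β/π + 3)/β ≤ Λ₁/π + 3/128`).
[cite: BenfattoGiulianiMastropietro2006, §2.8 (2.80)] -/
theorem isGramBoundedR_klStepCov_zero_uniform {R : RenConsts} {U : ℝ} {N : ℕ} {μ : ℝ} {K : TrigPolyC4v} (hK : FrameOK R U N μ K)
    {β : ℝ} (hβ : klBetaMin ≤ β) :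
    IsGramBoundedR (klStepCov V M β μ K 0)
      (Real.sqrt (8 * (klScale klE0 1 / Real.pi + 3 / 128) * (1793 * klScale klE0 1 + 704) / klScale klE0 1)) := by
  have hβ128 : (128 : ℝ) ≤ β := by simpa [klBetaMin] using hβ
  have hβ0 : 0 < β := by linarith
  have hΛ : 0 < klScale klE0 1 := klth_klScale_pos 1
  refine IsGramBoundedR.mono (isGramBoundedR_klStepCov_zero_of_frameOK (V := V) (M := M) hK hβ0) (Real.sqrt_nonneg _) (Real.sqrt_le_sqrt ?_)
  rw [div_le_div_iff₀ (by positivity) hΛ]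
  have h1 : klScale klE0 1 * β / Real.pi + 3 ≤ (klScale klE0 1 / Real.pi + 3 / 128) * β := by
    have h3 : (3 : ℝ) ≤ 3 / 128 * β := by linarith
    have he : klScale klE0 1 * β / Real.pi = klScale klE0 1 / Real.pi * β := by ring
    rw [he, add_mul]
    linarith
  have h2 : 0 ≤ 8 * (1793 * klScale klE0 1 + 704) * klScale klE0 1 := by positivity
  calc 8 * (klScale klE0 1 * β / Real.pi + 3) * (1793 * klScale klE0 1 + 704) * klScale klE0 1
      = (klScale klE0 1 * β / Real.pi + 3) * (8 * (1793 * klScale klE0 1 + 704) * klScale klE0 1) := by ring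
    _ ≤ ((klScale klE0 1 / Real.pi + 3 / 128) * β) * (8 * (1793 * klScale klE0 1 + 704) * klScale klE0 1) :=
        mul_le_mul_of_nonneg_right h1 h2
    _ = 8 * (klScale klE0 1 / Real.pi + 3 / 128) * (1793 * klScale klE0 1 + 704) * (β * klScale klE0 1) := by ring

end Summit.HubbardSuperconductivity.HubbardSuperconductivity.Theorems.TwoVolumeSource

end
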